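import Summits.HubbardSuperconductivity.HubbardSuperconductivity.Theses.AposterioriCapRg

/-!
# Restatement kit for crux [3] `SeededBrokenRegimeBoseFermiPinned` (stmt-HubbardSuperconductivity-14047)

Crux-strategist `planner-cstrat-stmt-HubbardSuperconductivity-14047-p1-0` (wall-breaker, gen 1), 2026-08-17.
EVIDENCE FOR THE ROUTE-REPAIR / TENURE PLANNER AND THE HUMAN — nothing here is asserted about the model; every
theorem is pure logic over the route's decls and elaborates against the current tree.

## What this file establishes (kernel-checked)

* `crux_iff_forall_above` — the crux in NORMAL FORM:
  `SeededBrokenRegimeBoseFermiPinned ↔ ∀ η₀ > 0, SeededBrokenRegimeBoseFermiAbove η₀`, where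
  `SeededBrokenRegimeBoseFermiAbove η₀` := "for every stiffness threshold `kStar > 0` there is a tolerance `Θ` such that at
  every v3-certified point of the box the conclusion holds at remainder threshold `η₀`".  So the crux is the conjunction over
  ALL remainder thresholds `η₀ > 0` of the honest fixed-threshold theorems; the standing disprover's anomalous-block floor
  (Disproof.lean F1/F6, kernel half N1–N8, `Negative/…FalseOfAnomalousBlockFloorHyp`) says exactly that the conjuncts with
  `η₀ < c_W` fail at every certified point.  A restatement keeps the conjuncts above the floor and nothing else changes.
* `crux_of_above_of_improvable` — the DEFECT ISOLATED: `Above η₀ → RemainderImprovableBelow η₀ → crux`, where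
  `RemainderImprovableBelow η₀` ("a datum certified at remainder `η₀` can be traded for one at any smaller remainder") is the
  `∀ etaStar` design principle of the report D1″ in one line — the statement the floor refutes on paper.  This is the best
  typed DECOMPOSITION of the crux as filed (census §Decomposition): one child is the honest theorem, the other is the defect;
  it is deliberately NOT filed as a route split, because child 1 IS the restatement (a tenure move) and `η₀` is a [3]–R
  interface literal.
* `AposterioriOrderCriterionRAbove η₀`, `r_iff_exists_rAbove` — R (stmt-13884) in the same normal form:
  `AposterioriOrderCriterionR ↔ ∃ η₀ > 0, RAbove η₀`.
* `fixedPoint_of_above` — THE RESTATED CHAIN CLOSES BY PURE LOGIC for ANY shared literal `η₀`: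
  `CapRgSymmetricCertificatePinned → Above η₀ → RAbove η₀ → FixedPointDWaveOrder`; and `closes_of_above` reaches the summit
  with `SsbToEvenTorusLro` exactly as the route's `closes` does.  So the repair is: restate [3] := `Above η₀`, R := `RAbove η₀`
  (one literal `η₀`, e.g. `1/4`; see STRATEGY-CENSUS.md §Restatement for why the literal must sit above the D1″ floor
  `≈ 0.05–0.1` and why the better repair is a U(1)-complete report D1‴-θ), `closes` re-proved by `closes_of_above`.
* `fixedPoint_of_above_pointwise` — the producer may even be weakened to the pointwise `[2′]` (one point per tolerance).
* `aboveCapped_imp_above` — drefute W1's scale cap `D.scale ≤ Λ·e⁻⁸/30` is a harmless strengthening of `Above`.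

rc 0, 0 sorry expected; axioms `propext / Classical.choice / Quot.sound`.
-/

set_option linter.dupNamespace false

namespace Summit.HubbardSuperconductivity.HubbardSuperconductivity.Cruxes.SeededBrokenRegimeBoseFermiPinned.Strategist

open Summit.HubbardSuperconductivity.HubbardSuperconductivity.Theses.AposterioriCapRg
open Literature.MathematicalPhysics.QuantumLattice

/-! ### §1 Vocabulary (byte-identical pieces of the crux) -/

/-- The density clause of the box (as in `FixedPointDWaveOrder` / `[2]` / `[3]`). -/
def Dens (U μ δ : ℝ) : Prop :=
  Filter.Tendsto (fun L : ℕ => ((hubbardTorusWith 2 (L + 1) 1 U μ).groundStateFunctional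
    totalNumber).re / ((L + 1 : ℕ) : ℝ) ^ 2) Filter.atTop (nhds (1 - δ))

/-- The conclusion of the crux at thresholds `(kStar, etaStar)` and the point `(U, μ)`. -/
def Concl (kStar etaStar : ℚ) (U μ : ℝ) : Prop :=
  ∃ h₀ : ℝ, 0 < h₀ ∧ ∃ D : HubbardScaleData, D.MeetsThresholds kStar etaStar ∧ 0 < D.numPatches ∧
    0 < D.meanFieldDensity.fst ∧
    ∀ h ∈ Set.Ioc (0:ℝ) h₀, ∃ L₀' : ℕ, D.IsCertifiedEnclosure (hubbardScaleReportCT U μ D h) L₀'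

/-- "Some v3 certificate at tolerance `Θ` exists at the point `(U, μ)`". -/
def CertAt (Θ : SymmetricTolerance) (U μ : ℝ) : Prop :=
  ∃ (K : TrigPolyC4v) (Λ : ℝ) (L₀ : ℕ), symmetricRegimeCertificateT U μ capRgCornerDataT Θ K Λ L₀

/-! ### §2 The honest conjunct: the crux ABOVE a pinned remainder threshold -/

/-- **`SeededBrokenRegimeBoseFermiAbove η₀`** — the h-uniform Bose–Fermi theorem at the pinned v3 interface with the
remainder threshold PINNED at `η₀` and ALL stiffness thresholds: for every `kStar > 0` there is a tolerance `Θ` such that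
at every point of the box with the density clause, every v3 certificate at `Θ` yields `Concl kStar η₀`.
(The shape of restatement option (α) of LEAD_VERDICT.md with `∀ kStar` kept — the disprover records that `∀ kStar` is not
hit by the floor; keeping it lets R choose its stiffness threshold freely, so only ONE literal is shared.) -/
def SeededBrokenRegimeBoseFermiAbove (η₀ : ℚ) : Prop :=
  ∀ kStar : ℚ, 0 < kStar → ∃ Θ : SymmetricTolerance,
    ∀ U ∈ Set.Icc (2:ℝ) 3, ∀ δ ∈ Set.Icc (1/5:ℝ) (7/20), ∀ μ : ℝ, Dens U μ δ →
      ∀ (K : TrigPolyC4v) (Λ : ℝ) (L₀ : ℕ),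
        symmetricRegimeCertificateT U μ capRgCornerDataT Θ K Λ L₀ → Concl kStar η₀ U μ

/-- `Concl` is monotone in the remainder threshold (and antitone in the stiffness threshold). -/
theorem concl_mono {kStar kStar' etaStar etaStar' : ℚ} (hk' : 0 ≤ kStar') (hk : kStar' ≤ kStar)
    (he : etaStar ≤ etaStar') {U μ : ℝ} (h : Concl kStar etaStar U μ) : Concl kStar' etaStar' U μ := by
  obtain ⟨h₀, hh₀, D, hmeets, hNp, hm, hencl⟩ := h
  exact ⟨h₀, hh₀, D, hmeets.mono hk' hk he, hNp, hm, hencl⟩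

/-- `Above` is monotone in `η₀`: a larger remainder threshold is easier. -/
theorem above_mono {η₀ η₁ : ℚ} (hle : η₀ ≤ η₁) (h : SeededBrokenRegimeBoseFermiAbove η₀) :
    SeededBrokenRegimeBoseFermiAbove η₁ := by
  intro kStar hk
  obtain ⟨Θ, hΘ⟩ := h kStar hk
  exact ⟨Θ, fun U hU δ hδ μ hd K Λ L₀ hc => concl_mono hk.le le_rfl hle (hΘ U hU δ hδ μ hd K Λ L₀ hc)⟩

/-- **The crux implies every conjunct**: `S → Above η₀` for every `η₀ > 0` (so `Above η₀` is WEAKER than the crux). -/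
theorem above_of_crux (hS : SeededBrokenRegimeBoseFermiPinned) {η₀ : ℚ} (hη : 0 < η₀) :
    SeededBrokenRegimeBoseFermiAbove η₀ :=
  fun kStar hk => hS kStar η₀ hk hη

/-- **NORMAL FORM OF THE CRUX**: it is the conjunction of the fixed-threshold theorems over all `η₀ > 0`. -/
theorem crux_iff_forall_above :
    SeededBrokenRegimeBoseFermiPinned ↔ ∀ η₀ : ℚ, 0 < η₀ → SeededBrokenRegimeBoseFermiAbove η₀ :=
  ⟨fun hS _ hη => above_of_crux hS hη, fun h kStar etaStar hk he => h etaStar he kStar hk⟩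

/-- Countable normal form: the conjuncts at `η₀ = 1/(n+1)` suffice. -/
theorem crux_iff_forall_above_nat :
    SeededBrokenRegimeBoseFermiPinned ↔ ∀ n : ℕ, SeededBrokenRegimeBoseFermiAbove (1 / ((n : ℚ) + 1)) := by
  rw [crux_iff_forall_above]
  refine ⟨fun h n => h _ (by positivity), fun h η₀ hη => ?_⟩
  obtain ⟨n, hn⟩ := exists_nat_one_div_lt hη
  exact above_mono hn.le (h n)

/-! ### §3 The defect isolated: remainder improvability below the pinned threshold -/

/-- **`RemainderImprovableBelow η₀`** — the `∀ etaStar` design principle of the report D1″ in one line: at any point and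
any stiffness threshold, an h-uniformly certified datum with remainder ceiling `η₀` can be traded for one with an
arbitrarily small remainder ceiling.  TRUE for a normal form whose non-kept part is irrelevant (remainders shrink as the
scale is lowered); FALSE ON PAPER for D1″ at every point carrying the intended `d`-wave condensate, because the anomalous
`B₁g` block `½V_⊥(q)(BB + B̄B̄)` is not kept by `cooperKeptCT` and is MARGINAL with h-uniform value `c_W ≈ 4·10⁻³–4·10⁻²`
(Disproof.lean F1; kernel half N2/N5/N7/N8).  Not Lean-decidable either way (needs an SSB point). -/
def RemainderImprovableBelow (η₀ : ℚ) : Prop :=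
  ∀ (U μ : ℝ) (kStar etaStar : ℚ), 0 < kStar → 0 < etaStar → etaStar < η₀ →
    Concl kStar η₀ U μ → Concl kStar etaStar U μ

/-- **THE DECOMPOSITION**: honest conjunct + isolated defect ⇒ the crux as filed.  (`η₀` arbitrary.) -/
theorem crux_of_above_of_improvable {η₀ : ℚ} (h₁ : SeededBrokenRegimeBoseFermiAbove η₀)
    (h₂ : RemainderImprovableBelow η₀) : SeededBrokenRegimeBoseFermiPinned := by
  intro kStar etaStar hk he
  obtain ⟨Θ, hΘ⟩ := h₁ kStar hk
  refine ⟨Θ, fun U hU δ hδ μ hd K Λ L₀ hc => ?_⟩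
  have hη₀ := hΘ U hU δ hδ μ hd K Λ L₀ hc
  rcases lt_or_ge etaStar η₀ with hlt | hge
  · exact h₂ U μ kStar etaStar hk he hlt hη₀
  · exact concl_mono hk.le le_rfl hge hη₀

/-- Conversely the crux gives improvability AT CERTIFIED POINTS (the only place it speaks): recorded to make precise that
`RemainderImprovableBelow` is logically independent of the crux (it also speaks at uncertified points). -/
theorem improvable_at_certified_of_crux (hS : SeededBrokenRegimeBoseFermiPinned) (kStar etaStar : ℚ) (hk : 0 < kStar)
    (he : 0 < etaStar) :
    ∃ Θ : SymmetricTolerance, ∀ U ∈ Set.Icc (2:ℝ) 3, ∀ δ ∈ Set.Icc (1/5:ℝ) (7/20), ∀ μ : ℝ, Dens U μ δ →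
      CertAt Θ U μ → Concl kStar etaStar U μ := by
  obtain ⟨Θ, hΘ⟩ := hS kStar etaStar hk he
  exact ⟨Θ, fun U hU δ hδ μ hd ⟨K, Λ, L₀, hc⟩ => hΘ U hU δ hδ μ hd K Λ L₀ hc⟩

/-! ### §4 The consumer R in the same normal form, and the restated chain -/

/-- **`AposterioriOrderCriterionRAbove η₀`** — R (stmt-13884) with its remainder threshold pinned at `η₀` and its stiffness
threshold still its own choice: `∃ kStar > 0, ∀ U μ h₀ D, … certified … → D.MeetsThresholds kStar η₀ → m₀/2 ≤ dWaveOrderParameter`. -/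
def AposterioriOrderCriterionRAbove (η₀ : ℚ) : Prop :=
  ∃ kStar : ℚ, 0 < kStar ∧ ∀ (U μ h₀ : ℝ) (D : HubbardScaleData), 0 < h₀ →
    (∀ h ∈ Set.Ioc (0:ℝ) h₀, ∃ L₀ : ℕ, D.IsCertifiedEnclosure (hubbardScaleReportCT U μ D h) L₀) →
    D.MeetsThresholds kStar η₀ → ((D.meanFieldDensity.fst : ℚ) : ℝ) / 2 ≤ dWaveOrderParameter U μ

/-- R as filed is `∃ η₀ > 0, RAbove η₀` (definitional reshuffle). -/
theorem r_iff_exists_rAbove :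
    AposterioriOrderCriterionR ↔ ∃ η₀ : ℚ, 0 < η₀ ∧ AposterioriOrderCriterionRAbove η₀ :=
  ⟨fun ⟨kStar, etaStar, hk, he, h⟩ => ⟨etaStar, he, kStar, hk, h⟩,
    fun ⟨etaStar, he, kStar, hk, h⟩ => ⟨kStar, etaStar, hk, he, h⟩⟩

/-- `RAbove` is antitone in `η₀`: a criterion tolerating remainder `η₁` tolerates every `η₀ ≤ η₁`. -/
theorem rAbove_antitone {η₀ η₁ : ℚ} (hle : η₀ ≤ η₁) (h : AposterioriOrderCriterionRAbove η₁) :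
    AposterioriOrderCriterionRAbove η₀ := by
  obtain ⟨kStar, hk, h⟩ := h
  exact ⟨kStar, hk, fun U μ h₀ D hh₀ hencl hmeets => h U μ h₀ D hh₀ hencl (hmeets.mono hk.le le_rfl hle)⟩

/-- **THE RESTATED CHAIN CLOSES BY PURE LOGIC, for ANY shared literal `η₀`**:
`[2] → Above η₀ → RAbove η₀ → FixedPointDWaveOrder`. -/
theorem fixedPoint_of_above (η₀ : ℚ) (h2 : CapRgSymmetricCertificatePinned)
    (h3 : SeededBrokenRegimeBoseFermiAbove η₀) (hR : AposterioriOrderCriterionRAbove η₀) :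
    FixedPointDWaveOrder := by
  obtain ⟨kStar, hk, hRall⟩ := hR
  obtain ⟨Θ, h3all⟩ := h3 kStar hk
  obtain ⟨U, hU, δ, hδ, μ, hdens, hcert⟩ := h2
  obtain ⟨K, Λ, L₀, hc⟩ := hcert Θ
  obtain ⟨h₀, hh₀, D, hmeets, -, hm₀, hencl⟩ := h3all U hU δ hδ μ hdens K Λ L₀ hc
  have hle := hRall U μ h₀ D hh₀ hencl hmeets
  have hm₀' : (0 : ℝ) < ((D.meanFieldDensity.fst : ℚ) : ℝ) := by exact_mod_cast hm₀
  refine ⟨U, hU, δ, hδ, μ, hdens, ?_⟩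
  rw [hasDWaveOrder_iff]
  linarith

/-- **The restated route still decides the summit** (the body of the route's `closes`, with [3], R replaced):
`[2] → Above η₀ → RAbove η₀ → SsbToEvenTorusLro → HubbardSuperconductivity`. -/
theorem closes_of_above (η₀ : ℚ) (h2 : CapRgSymmetricCertificatePinned)
    (h3 : SeededBrokenRegimeBoseFermiAbove η₀) (hR : AposterioriOrderCriterionRAbove η₀)
    (hS : SsbToEvenTorusLro) : _root_.HubbardSuperconductivity := by
  obtain ⟨U, hU, δ, hδ, μ, hdens, hord⟩ := fixedPoint_of_above η₀ h2 h3 hR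
  have hU0 : (0 : ℝ) < U := by linarith [hU.1]
  have hδ' : δ ∈ Set.Ioo (0 : ℝ) 1 := ⟨by linarith [hδ.1], by linarith [hδ.2]⟩
  unfold HubbardSuperconductivity Literature.Hubbard.DWaveSuperconductivityHubbard
  refine ⟨U, hU0, δ, ⟨by linarith [hδ.1], by linarith [hδ.2]⟩, ?_⟩
  intro N ψ hψ
  exact hS U δ μ hU0 hδ' hdens hord N ψ hψ

/-- Sanity: the CURRENT `closes` factors through the normal forms — R supplies its own `η₀`, the crux supplies
`Above η₀` (so nothing is lost by the reshuffle; what the restatement drops is only the conjuncts below R's `η₀`…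
except that R's `η₀` is ∃-bound and may be below the floor, which is the whole defect). -/
theorem fixedPoint_of_current (h2 : CapRgSymmetricCertificatePinned) (h3 : SeededBrokenRegimeBoseFermiPinned)
    (hR : AposterioriOrderCriterionR) : FixedPointDWaveOrder := by
  obtain ⟨η₀, hη, hRA⟩ := r_iff_exists_rAbove.1 hR
  exact fixedPoint_of_above η₀ h2 (above_of_crux h3 hη) hRA

/-- The pointwise producer `[2′]` (one certified point PER tolerance; Disproof.lean §8) already suffices. -/
def CapRgPointwise : Prop :=
  ∀ Θ : SymmetricTolerance, ∃ U ∈ Set.Icc (2:ℝ) 3, ∃ δ ∈ Set.Icc (1/5:ℝ) (7/20), ∃ μ : ℝ, Dens U μ δ ∧ CertAt Θ U μ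

/-- `[2] → [2′]`. -/
theorem capRgPointwise_of_capRg (h : CapRgSymmetricCertificatePinned) : CapRgPointwise := by
  obtain ⟨U, hU, δ, hδ, μ, hd, hall⟩ := h
  exact fun Θ => ⟨U, hU, δ, hδ, μ, hd, hall Θ⟩

/-- `[2′] → Above η₀ → RAbove η₀ → FixedPointDWaveOrder`. -/
theorem fixedPoint_of_above_pointwise (η₀ : ℚ) (h2 : CapRgPointwise)
    (h3 : SeededBrokenRegimeBoseFermiAbove η₀) (hR : AposterioriOrderCriterionRAbove η₀) :
    FixedPointDWaveOrder := by
  obtain ⟨kStar, hk, hRall⟩ := hR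
  obtain ⟨Θ, h3all⟩ := h3 kStar hk
  obtain ⟨U, hU, δ, hδ, μ, hdens, K, Λ, L₀, hc⟩ := h2 Θ
  obtain ⟨h₀, hh₀, D, hmeets, -, hm₀, hencl⟩ := h3all U hU δ hδ μ hdens K Λ L₀ hc
  have hle := hRall U μ h₀ D hh₀ hencl hmeets
  have hm₀' : (0 : ℝ) < ((D.meanFieldDensity.fst : ℚ) : ℝ) := by exact_mod_cast hm₀
  refine ⟨U, hU, δ, hδ, μ, hdens, ?_⟩
  rw [hasDWaveOrder_iff]
  linarith

/-! ### §5 Vacuity is the only way the conjuncts below the floor can hold -/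

/-- If some tolerance is certified nowhere in the box, EVERY conjunct holds with no content (hence the crux):
the only mechanism by which `Above η₀` for `η₀` below the floor can be true — and it refutes the sister crux's
pointwise form `[2′]`. -/
theorem above_of_uninstantiable (h : ∃ Θ : SymmetricTolerance, ∀ U ∈ Set.Icc (2:ℝ) 3,
    ∀ δ ∈ Set.Icc (1/5:ℝ) (7/20), ∀ μ : ℝ, Dens U μ δ → ¬ CertAt Θ U μ) (η₀ : ℚ) :
    SeededBrokenRegimeBoseFermiAbove η₀ := by
  obtain ⟨Θ, hΘ⟩ := h
  exact fun kStar _ => ⟨Θ, fun U hU δ hδ μ hd K Λ L₀ hc => absurd ⟨K, Λ, L₀, hc⟩ (hΘ U hU δ hδ μ hd)⟩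

/-- `¬[2′] → Above η₀` for all `η₀`. -/
theorem above_of_not_capRgPointwise (h : ¬ CapRgPointwise) (η₀ : ℚ) : SeededBrokenRegimeBoseFermiAbove η₀ := by
  apply above_of_uninstantiable
  obtain ⟨Θ, hΘ⟩ := not_forall.mp h
  exact ⟨Θ, fun U hU δ hδ μ hd hc => hΘ ⟨U, hU, δ, hδ, μ, hd, hc⟩⟩

/-! ### §6 The scale-capped variant (drefute W1) is a strengthening -/

/-- `Above` with drefute's scale cap `D.scale ≤ Λ·e⁻⁸/30` inside `∃ D` (the shape of RestatementCandidates'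
`SeededBrokenRegimeBoseFermiPinnedAt`, with `∀ kStar`). -/
def SeededBrokenRegimeBoseFermiAboveCapped (η₀ : ℚ) : Prop :=
  ∀ kStar : ℚ, 0 < kStar → ∃ Θ : SymmetricTolerance,
    ∀ U ∈ Set.Icc (2:ℝ) 3, ∀ δ ∈ Set.Icc (1/5:ℝ) (7/20), ∀ μ : ℝ, Dens U μ δ →
      ∀ (K : TrigPolyC4v) (Λ : ℝ) (L₀ : ℕ), symmetricRegimeCertificateT U μ capRgCornerDataT Θ K Λ L₀ →
        ∃ h₀ : ℝ, 0 < h₀ ∧ ∃ D : HubbardScaleData, (D.scale : ℝ) ≤ Λ * Real.exp (-8) / 30 ∧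
          D.MeetsThresholds kStar η₀ ∧ 0 < D.numPatches ∧ 0 < D.meanFieldDensity.fst ∧
          ∀ h ∈ Set.Ioc (0:ℝ) h₀, ∃ L₀' : ℕ, D.IsCertifiedEnclosure (hubbardScaleReportCT U μ D h) L₀'

/-- Forgetting the cap. -/
theorem aboveCapped_imp_above {η₀ : ℚ} (h : SeededBrokenRegimeBoseFermiAboveCapped η₀) :
    SeededBrokenRegimeBoseFermiAbove η₀ := by
  intro kStar hk
  obtain ⟨Θ, hΘ⟩ := h kStar hk
  refine ⟨Θ, fun U hU δ hδ μ hd K Λ L₀ hc => ?_⟩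
  obtain ⟨h₀, hh₀, D, -, hmeets, hNp, hm, hencl⟩ := hΘ U hU δ hδ μ hd K Λ L₀ hc
  exact ⟨h₀, hh₀, D, hmeets, hNp, hm, hencl⟩

/-- RestatementCandidates' fixed-threshold item `[3]At k₀ η₀` (lead c1) is the `kStar = k₀` instance of the capped
conjunct: `AboveCapped η₀ → [3]At k₀ η₀`-shape for every `k₀ > 0` (stated inline to avoid importing the work file). -/
theorem at_of_aboveCapped {η₀ : ℚ} (h : SeededBrokenRegimeBoseFermiAboveCapped η₀) (k₀ : ℚ) (hk : 0 < k₀) :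
    ∃ Θ : SymmetricTolerance, ∀ U ∈ Set.Icc (2:ℝ) 3, ∀ δ ∈ Set.Icc (1/5:ℝ) (7/20), ∀ μ : ℝ, Dens U μ δ →
      ∀ (K : TrigPolyC4v) (Λ : ℝ) (L₀ : ℕ), symmetricRegimeCertificateT U μ capRgCornerDataT Θ K Λ L₀ →
        ∃ h₀ : ℝ, 0 < h₀ ∧ ∃ D : HubbardScaleData, (D.scale : ℝ) ≤ Λ * Real.exp (-8) / 30 ∧
          D.MeetsThresholds k₀ η₀ ∧ 0 < D.numPatches ∧ 0 < D.meanFieldDensity.fst ∧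
          ∀ h ∈ Set.Ioc (0:ℝ) h₀, ∃ L₀' : ℕ, D.IsCertifiedEnclosure (hubbardScaleReportCT U μ D h) L₀' :=
  h k₀ hk

end Summit.HubbardSuperconductivity.HubbardSuperconductivity.Cruxes.SeededBrokenRegimeBoseFermiPinned.Strategist
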